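import Summits.NavierStokesRegularity.NavierStokesRegularity.Theorems.TypeICertificateLadderTargetFiveHalvesWindowDepletedSlabLaw
import Summits.NavierStokesRegularity.NavierStokesRegularity.Theorems.TypeICertificateLadderTargetFiveHalvesWindowDepletedApriori
import Summits.NavierStokesRegularity.NavierStokesRegularity.Theorems.TypeICertificateLadderTargetFiveHalvesWindowRung
import Summits.NavierStokesRegularity.NavierStokesRegularity.Theorems.Target.Negative.ExplicitTypeIConstantSlab

/-!
# Crux `Target` (stmt-NavierStokesRegularity-1217), line `depletion-ladder` at `q = 5/2`: RUNGS FROM A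
# DEPLETION CONSTANT — `X_C` for every `(κ² + 1/2)·C² < 8/5`

`--supports stmt-NavierStokesRegularity-1217` (file 4 of the depleted `q = 5/2` chain; the `q = 5/2`
analogue of stub S2 `rung_of_stretchingDepletion`, p471856, whose `q = 2` reach is `κC < 1`).
Under the `q = 5/2` DEPLETION LAW with constant `κ` (hypothesis `hlaw`: for every `C³`
divergence-free `v` bounded by `M`, with bounded gradient `‖Dv‖ ≤ B` and `Dv, D²v ∈ L²`, the weighted Lamb pairing
`∫(|ω|²+1)^{1/4}⟪(ω·∇)ω, v⟫` is at most `κ·M·(∫wt|ω|²)^{1/2}(∫wt Σᵢ|∂ᵢω|²)^{1/2}`, `ω = curl v`;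
`κ = 1` is Cauchy–Schwarz), every rung `X_C` with `(κ² + 1/2)·C² < 8/5` holds
(`rung_of_depletion_fiveHalves`): the a-priori rates with slab coefficient `5c/2`,
`c = max((2κ²+1)/8, 7/(20C²))` (`aprioriDecay_of_rate_coeff`, `depletedSlab_law`), the generic rate step
(`enstrophyDecay_step`) iterated to the fixed point `2α − 3/2`, `α = 5cC²/2 < 1`, and Tao's `H¹`
lifespan bound (`hasSmoothExtensionPast_of_decay`). This is EXACTLY the bookkeeping threshold
`(κ_A² + 1/2)C² < 8/5` of `DepletionLadder.depletedBudgetCloses_five_halves_iff`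
(`TypeICertificateLadderTargetDepletedBudgetReach.lean`), now an honest theorem about Navier–Stokes:
any certified `κ < 0.9964` is a rung above the `√6 − √2` ceiling, and `κ → 0` reaches `C → √(16/5)`.
Numerically (kit j269896/j270796, `--workitem 1217`) the `q = 5/2` ratio found by gradient ascent is
`≈ 0.14`. The law IS INHABITED at the Cauchy–Schwarz value: `law_one` (so the implication is not
vacuous, and `κ = 1` re-derives the window `C² < 16/15`, closing `example`); every
integral in the law is finite under its own premises (the gradient bound makes the weight bounded).
WHAT THIS IS NOT: no depletion constant `κ < 1` is proved here (S1 open). [folklore: bookkeeping]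
-/

noncomputable section

open Set Filter Topology MeasureTheory
open scoped RealInnerProductSpace ENNReal NNReal Laplacian ContDiff
open Literature.Analysis.FluidPDE

namespace Summit.NavierStokesRegularity.NavierStokesRegularity.Theorems.FiveHalvesWindow

-- the problem directory `NavierStokesRegularity/NavierStokesRegularity` forces the duplicated namespace
set_option linter.dupNamespace false

open Summit.NavierStokesRegularity.NavierStokesRegularity.Theorems.RungReynoldsOne
open Summit.NavierStokesRegularity.NavierStokesRegularity.Theorems.RungReynoldsOne.WeightedSlice

/-! ## The bootstrap with a general slab exponent `α` -/

/-- The recursion of the explicit exponents `b_n = (2α − 3/2) + (3/5)^n (C²/2 − (2α − 3/2))`: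
`b_{n+1} = 3b_n/5 + 4α/5 − 3/5`. -/
theorem bootExpα_succ (α C : ℝ) (n : ℕ) :
    (2 * α - 3 / 2 + (3 / 5 : ℝ) ^ (n + 1) * (C ^ 2 / 2 - (2 * α - 3 / 2))) =
      3 * (2 * α - 3 / 2 + (3 / 5 : ℝ) ^ n * (C ^ 2 / 2 - (2 * α - 3 / 2))) / 5 + 4 * α / 5 - 3 / 5 := by
  rw [pow_succ]; ring

/-- **The depleted bootstrap.** Given the rates `∫F(curl u) ≤ K₁(T−t)^{-α}`, `|u|² ≤ M/(T−t)` and an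
initial enstrophy rate `∫|∇u|² ≤ K₂(T−t)^{-C²/2}` on `(0,T)`, with `3/4 < α` and `2α − 3/2 ≤ C²/2`:
for every `n`, `∫|∇u(t)|² ≤ K_n(T−t)^{-b_n}` on `(0,T)` and
`‖u(t)‖₂² + ‖∇u(t)‖₂² ≤ K'_n(T−t)^{-b_{n+1}}` on `[T/2,T)`. -/
theorem zRate_bootstrapα {ν T : ℝ} (hν : 0 < ν) (hT : 0 < T)
    {u : ℝ → EuclideanSpace ℝ (Fin 3) → EuclideanSpace ℝ (Fin 3)}
    {p : ℝ → EuclideanSpace ℝ (Fin 3) → ℝ}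
    (hsol : IsClassicalNSSolutionOn (Ico 0 T) ν 0 u p) (hLH : IsLerayHopfOn T ν 0 (u 0) u)
    (hdec : HasRapidSpatialDecay (u 0)) {α C K₁ K₂ M : ℝ} (hα : 3 / 4 < α)
    (hαC : 2 * α - 3 / 2 ≤ C ^ 2 / 2)
    (hb : ∀ t ∈ Ioo 0 T,
      (∫⁻ x, ENNReal.ofReal ((‖curl (u t) x‖ ^ 2 + 1) ^ (5 / 4 : ℝ) - 1) ≤
        ENNReal.ofReal (K₁ * (T - t) ^ (-α))) ∧
      (∫⁻ x, ENNReal.ofReal (frobeniusNormSq (fderiv ℝ (u t) x)) ≤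
        ENNReal.ofReal (K₂ * (T - t) ^ (-(C ^ 2 / 2)))) ∧
      (∀ x, ‖u t x‖ ^ 2 ≤ M / (T - t))) (n : ℕ) :
    (∃ K : ℝ, ∀ t ∈ Ioo 0 T,
      ∫⁻ x, ENNReal.ofReal (frobeniusNormSq (fderiv ℝ (u t) x)) ≤
        ENNReal.ofReal (K * (T - t) ^ (-(2 * α - 3 / 2 + (3 / 5 : ℝ) ^ n * (C ^ 2 / 2 - (2 * α - 3 / 2)))))) ∧
    (∃ K : ℝ, ∀ t ∈ Ico (T / 2) T,
      (∫⁻ x, ‖u t x‖ₑ ^ 2) + ∫⁻ x, ENNReal.ofReal (frobeniusNormSq (fderiv ℝ (u t) x)) ≤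
        ENNReal.ofReal (K * (T - t) ^
          (-(2 * α - 3 / 2 + (3 / 5 : ℝ) ^ (n + 1) * (C ^ 2 / 2 - (2 * α - 3 / 2)))))) := by
  have hfix : ∀ n : ℕ, 2 * α - 3 / 2 ≤
      2 * α - 3 / 2 + (3 / 5 : ℝ) ^ n * (C ^ 2 / 2 - (2 * α - 3 / 2)) := fun n => by
    have h1 : 0 ≤ C ^ 2 / 2 - (2 * α - 3 / 2) := by linarith
    have h2 : 0 ≤ (3 / 5 : ℝ) ^ n := by positivity
    nlinarith [mul_nonneg h2 h1]
  -- the step at stage `n`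
  have step : ∀ n : ℕ, ∀ K : ℝ, (∀ t ∈ Ioo 0 T,
      ∫⁻ x, ENNReal.ofReal (frobeniusNormSq (fderiv ℝ (u t) x)) ≤
        ENNReal.ofReal (K * (T - t) ^
          (-(2 * α - 3 / 2 + (3 / 5 : ℝ) ^ n * (C ^ 2 / 2 - (2 * α - 3 / 2)))))) →
      ∃ K' : ℝ, ∀ t ∈ Ico (T / 2) T,
        (∫⁻ x, ‖u t x‖ₑ ^ 2) + ∫⁻ x, ENNReal.ofReal (frobeniusNormSq (fderiv ℝ (u t) x)) ≤
          ENNReal.ofReal (K' * (T - t) ^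
            (-(2 * α - 3 / 2 + (3 / 5 : ℝ) ^ (n + 1) * (C ^ 2 / 2 - (2 * α - 3 / 2))))) := by
    intro n K hK
    have hfixn := hfix n
    have he : 1 < (2 + 3 * (2 * α - 3 / 2 + (3 / 5 : ℝ) ^ n * (C ^ 2 / 2 - (2 * α - 3 / 2)))) / 5 +
        4 * α / 5 := by nlinarith
    have hb' : ∀ t ∈ Ioo 0 T,
        (∫⁻ x, ENNReal.ofReal ((‖curl (u t) x‖ ^ 2 + 1) ^ (5 / 4 : ℝ) - 1) ≤
          ENNReal.ofReal (K₁ * (T - t) ^ (-α))) ∧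
        (∫⁻ x, ENNReal.ofReal (frobeniusNormSq (fderiv ℝ (u t) x)) ≤
          ENNReal.ofReal (K * (T - t) ^
            (-(2 * α - 3 / 2 + (3 / 5 : ℝ) ^ n * (C ^ 2 / 2 - (2 * α - 3 / 2)))))) ∧
        (∀ x, ‖u t x‖ ^ 2 ≤ M / (T - t)) :=
      fun t ht => ⟨(hb t ht).1, hK t ht, (hb t ht).2.2⟩
    obtain ⟨K', hK'⟩ := enstrophyDecay_step stub_enstrophyLambSlab stub_taoCover hν hT hsol hLH hdec he hb'
    refine ⟨K', fun t ht => (hK' t ht).trans_eq ?_⟩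
    congr 3
    rw [bootExpα_succ]
    ring
  induction n with
  | zero =>
      have h0 : ∃ K : ℝ, ∀ t ∈ Ioo 0 T,
          ∫⁻ x, ENNReal.ofReal (frobeniusNormSq (fderiv ℝ (u t) x)) ≤
            ENNReal.ofReal (K * (T - t) ^
              (-(2 * α - 3 / 2 + (3 / 5 : ℝ) ^ (0 : ℕ) * (C ^ 2 / 2 - (2 * α - 3 / 2))))) :=
        ⟨K₂, fun t ht => by
          rw [show (2 * α - 3 / 2 + (3 / 5 : ℝ) ^ (0 : ℕ) * (C ^ 2 / 2 - (2 * α - 3 / 2))) = C ^ 2 / 2 by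
            rw [pow_zero]; ring]
          exact (hb t ht).2.1⟩
      obtain ⟨K, hK⟩ := h0
      exact ⟨⟨K, hK⟩, step 0 K hK⟩
  | succ n ih =>
      obtain ⟨-, ⟨K, hK⟩⟩ := ih
      have hγ : 0 ≤ 2 * α - 3 / 2 + (3 / 5 : ℝ) ^ (n + 1) * (C ^ 2 / 2 - (2 * α - 3 / 2)) := by
        have := hfix (n + 1)
        linarith
      obtain ⟨K', hK'⟩ := zRate_of_Ico hν hT hsol hLH hdec hγ hK
      exact ⟨⟨K', hK'⟩, step (n + 1) K' hK'⟩

/-- For `α < 1` some bootstrap exponent drops below `1/2` (fixed point `2α − 3/2 < 1/2`). -/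
theorem exists_bootExpα_lt_half {α C : ℝ} (hα : α < 1) (hαC : 2 * α - 3 / 2 ≤ C ^ 2 / 2) :
    ∃ n : ℕ, (2 * α - 3 / 2 + (3 / 5 : ℝ) ^ (n + 1) * (C ^ 2 / 2 - (2 * α - 3 / 2))) < 1 / 2 := by
  have hgap : 0 < 1 / 2 - (2 * α - 3 / 2) := by linarith
  have hd : 0 < C ^ 2 / 2 - (2 * α - 3 / 2) + 1 := by linarith
  obtain ⟨n, hn⟩ := exists_pow_lt_of_lt_one (div_pos hgap hd) (by norm_num : (3 / 5 : ℝ) < 1)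
  refine ⟨n, ?_⟩
  have h35 : 0 ≤ (3 / 5 : ℝ) ^ (n + 1) := by positivity
  have hle : (3 / 5 : ℝ) ^ (n + 1) ≤ (3 / 5 : ℝ) ^ n := by
    rw [pow_succ]; nlinarith [pow_nonneg (by norm_num : (0:ℝ) ≤ 3 / 5) n]
  have hlt : (3 / 5 : ℝ) ^ (n + 1) * (C ^ 2 / 2 - (2 * α - 3 / 2) + 1) < 1 / 2 - (2 * α - 3 / 2) := by
    have := (lt_div_iff₀ hd).1 (hle.trans_lt hn)
    linarith
  nlinarith [hlt, h35]

/-- **RUNGS FROM A `q = 5/2` DEPLETION CONSTANT.** If the weighted Lamb pairing is depleted with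
constant `κ` on every admissible field (the `q = 5/2` depletion law, `κ = 1` = Cauchy–Schwarz),
then for every `C > 0` with `(κ² + 1/2)·C² < 8/5` rung `X_C` holds: every classical Leray–Hopf
rapidly-decaying-datum solution on `ℝ³ × [0,T)` with eventual collapse Reynolds number
`√(T−t)‖u(t,x)‖ ≤ C√ν` extends smoothly past `T`. (`κ = 1`: `C² < 16/15`, the window of
`rung_of_sq_lt_window`; `κ ≤ 0.9964`: rungs above `√6 − √2`; `κ → 0`: `C → √(16/5) = 1.788…`.) -/
theorem rung_of_depletion_fiveHalves {κ : ℝ}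
    (hlaw : ∀ (v : EuclideanSpace ℝ (Fin 3) → EuclideanSpace ℝ (Fin 3)) (M B : ℝ),
      ContDiff ℝ 3 v → VectorCalculus.IsDivFree v → (∀ x, ‖v x‖ ≤ M) →
      (∀ x, ‖fderiv ℝ v x‖ ≤ B) →
      (∫⁻ x, ‖iteratedFDeriv ℝ 1 v x‖ₑ ^ 2 < ⊤) → (∫⁻ x, ‖iteratedFDeriv ℝ 2 v x‖ₑ ^ 2 < ⊤) →
      |∫ x, (‖curl v x‖ ^ 2 + 1) ^ (1 / 4 : ℝ) * ⟪fderiv ℝ (curl v) x (curl v x), v x⟫| ≤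
        κ * M * Real.sqrt (∫ x, (‖curl v x‖ ^ 2 + 1) ^ (1 / 4 : ℝ) * ‖curl v x‖ ^ 2) *
          Real.sqrt (∫ x, (‖curl v x‖ ^ 2 + 1) ^ (1 / 4 : ℝ) *
            ∑ i, ‖fderiv ℝ (curl v) x (EuclideanSpace.basisFun (Fin 3) ℝ i)‖ ^ 2))
    {C : ℝ} (hC0 : 0 < C) (hC : (κ ^ 2 + 1 / 2) * C ^ 2 < 8 / 5) :
    ∀ (ν T : ℝ), 0 < ν → 0 < T →
      ∀ (u : ℝ → EuclideanSpace ℝ (Fin 3) → EuclideanSpace ℝ (Fin 3))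
        (p : ℝ → EuclideanSpace ℝ (Fin 3) → ℝ),
      IsClassicalNSSolutionOn (Set.Ico 0 T) ν 0 u p → IsLerayHopfOn T ν 0 (u 0) u →
      HasRapidSpatialDecay (u 0) →
      (∀ᶠ t in 𝓝[<] T, ∀ x, Real.sqrt (T - t) * ‖u t x‖ ≤ C * Real.sqrt ν) →
      HasSmoothExtensionPast ν 0 u T := by
  intro ν T hν hT u p hcl hLH hdec hrate
  by_cases hC1 : C ≤ 1
  · -- rate at most `√ν`: rung one
    have hrate1 : ∀ᶠ t in 𝓝[<] T, ∀ x, Real.sqrt (T - t) * ‖u t x‖ ≤ Real.sqrt ν := by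
      filter_upwards [hrate] with t ht x
      exact (ht x).trans (by nlinarith [Real.sqrt_nonneg ν])
    exact typeICertificateLadder_rungReynoldsOne ν T hν hT u p hcl hLH hdec hrate1
  · have hC1' : 1 < C := not_le.1 hC1
    have hC2 : 1 < C ^ 2 := by nlinarith
    -- the slab coefficient `c = max((2κ²+1)/8, 7/(20C²))`, `α = 5cC²/2 ∈ [7/8, 1)`
    set c : ℝ := max ((2 * κ ^ 2 + 1) / 8) (7 / (20 * C ^ 2)) with hcdef
    have hc : (2 * κ ^ 2 + 1) / 8 ≤ c := le_max_left _ _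
    have hc0 : 0 ≤ c := le_trans (by positivity) hc
    have hC20 : 0 < C ^ 2 := by positivity
    have hα34 : 3 / 4 < 5 * c * C ^ 2 / 2 := by
      have h7 : 7 / (20 * C ^ 2) ≤ c := le_max_right _ _
      have h7' : 7 / 20 ≤ c * C ^ 2 := by
        have h := (div_le_iff₀ (by positivity : (0:ℝ) < 20 * C ^ 2)).1 h7
        nlinarith
      linarith
    have hα1 : 5 * c * C ^ 2 / 2 < 1 := by
      rcases le_total ((2 * κ ^ 2 + 1) / 8) (7 / (20 * C ^ 2)) with h | h
      · have hc' : c = 7 / (20 * C ^ 2) := max_eq_right h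
        rw [hc']
        field_simp
        nlinarith
      · have hc' : c = (2 * κ ^ 2 + 1) / 8 := max_eq_left h
        rw [hc']
        nlinarith
    have hαC : 2 * (5 * c * C ^ 2 / 2) - 3 / 2 ≤ C ^ 2 / 2 := by linarith
    obtain ⟨K₁, K₂, M, hb⟩ := aprioriDecay_of_rate_coeff hc0
      (fun _ν _T hν hT _u _p hsol hu hut hp _s hs hfin =>
        Target.Negative.lintegral_frobeniusNormSq_le_exp_half_linfty hν hT hsol hu hut hp hs hfin)
      (depletedSlab_law hc hlaw stub_weightedVorticityBalance)
      stub_taoCover hν hT hC0 hcl hLH hdec hrate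
    obtain ⟨n, hn⟩ := exists_bootExpα_lt_half hα1 hαC
    obtain ⟨-, ⟨K, hK⟩⟩ := zRate_bootstrapα hν hT hcl hLH hdec hα34 hαC hb n
    exact hasSmoothExtensionPast_of_decay hν hT hcl hLH hdec hn ⟨by linarith, by linarith⟩ hK

/-- The reach as a function of the depletion constant: `(κ² + 1/2)C² < 8/5`, e.g. `κ = 1/2`:
`C < √(32/15) = 1.46…`; `κ = 0.14` (the numerical value): `C < 1.75…`; `κ = 0`: `C < √(16/5)`. -/
theorem reach_of_depletion_examples :
    ((1 / 2 : ℝ) ^ 2 + 1 / 2) * (1.46 : ℝ) ^ 2 < 8 / 5 ∧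
    ((0.14 : ℝ) ^ 2 + 1 / 2) * (1.75 : ℝ) ^ 2 < 8 / 5 ∧
    ((0 : ℝ) ^ 2 + 1 / 2) * (1.788 : ℝ) ^ 2 < 8 / 5 := by
  refine ⟨by norm_num, by norm_num, by norm_num⟩

/-! ## The law is inhabited at `κ = 1` (Cauchy–Schwarz) -/

/-- **The `q = 5/2` depletion law holds with `κ = 1`.** For `v ∈ C³` divergence free with `|v| ≤ M`,
`‖Dv‖ ≤ B`, `Dv, D²v ∈ L²` and `ω = curl v`, `wt = (|ω|²+1)^{1/4}`:
`|∫ wt⟪Dω(ω), v⟫| ≤ M (∫wt|ω|²)^{1/2} (∫wt Σᵢ‖∂ᵢω‖²)^{1/2}` — pointwise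
`‖Dω(ω)‖ ≤ ‖Dω‖‖ω‖ ≤ (Σᵢ‖∂ᵢω‖²)^{1/2}‖ω‖`, then Hölder; all three integrands are integrable because
the weight is bounded (`|ω| ≤ ‖curl‖·B`). So the hypothesis of `rung_of_depletion_fiveHalves` is not
vacuous. [folklore] -/
theorem law_one : ∀ (v : EuclideanSpace ℝ (Fin 3) → EuclideanSpace ℝ (Fin 3)) (M B : ℝ),
      ContDiff ℝ 3 v → VectorCalculus.IsDivFree v → (∀ x, ‖v x‖ ≤ M) →
      (∀ x, ‖fderiv ℝ v x‖ ≤ B) →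
      (∫⁻ x, ‖iteratedFDeriv ℝ 1 v x‖ₑ ^ 2 < ⊤) → (∫⁻ x, ‖iteratedFDeriv ℝ 2 v x‖ₑ ^ 2 < ⊤) →
      |∫ x, (‖curl v x‖ ^ 2 + 1) ^ (1 / 4 : ℝ) * ⟪fderiv ℝ (curl v) x (curl v x), v x⟫| ≤
        1 * M * Real.sqrt (∫ x, (‖curl v x‖ ^ 2 + 1) ^ (1 / 4 : ℝ) * ‖curl v x‖ ^ 2) *
          Real.sqrt (∫ x, (‖curl v x‖ ^ 2 + 1) ^ (1 / 4 : ℝ) *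
            ∑ i, ‖fderiv ℝ (curl v) x (EuclideanSpace.basisFun (Fin 3) ℝ i)‖ ^ 2) := by
  intro v M B hv _hdiv hM hB h1 h2
  set e := EuclideanSpace.basisFun (Fin 3) ℝ with he
  have he1 : ∀ i, ‖e i‖ = 1 := fun i => by simp [he]
  have hM0 : 0 ≤ M := (norm_nonneg _).trans (hM 0)
  have hv2 : ContDiff ℝ 2 v := hv.of_le (by norm_cast)
  have hDv : ContDiff ℝ 2 (fderiv ℝ v) := hv.fderiv_right (m := 2) (by norm_cast)
  have hω : ContDiff ℝ 2 (curl v) := by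
    rw [curl_eq_curlCLM_comp]; exact curlCLM.contDiff.comp hDv
  have hω1 : ContDiff ℝ 1 (curl v) := hω.of_le (by norm_cast)
  have cω : Continuous (curl v) := hω.continuous
  have cDω : Continuous (fderiv ℝ (curl v)) := hω1.continuous_fderiv one_ne_zero
  have cDωe : ∀ i, Continuous fun x => fderiv ℝ (curl v) x (e i) := fun i =>
    cDω.clm_apply continuous_const
  have cv : Continuous v := hv.continuous
  -- the weight is bounded
  set wt : EuclideanSpace ℝ (Fin 3) → ℝ := fun x => (‖curl v x‖ ^ 2 + 1) ^ (1 / 4 : ℝ) with hwtdef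
  have hwt0 : ∀ x, 0 ≤ wt x := fun x => Real.rpow_nonneg (by positivity) _
  have nω : ∀ x, ‖curl v x‖ ≤ ‖curlCLM‖ * B := fun x =>
    (norm_curl_le v x).trans (mul_le_mul_of_nonneg_left (hB x) (norm_nonneg curlCLM))
  set W₀ : ℝ := (‖curlCLM‖ * B) ^ 2 + 1 with hW₀
  have hwt : ∀ x, wt x ≤ W₀ := fun x =>
    (weight_le (curl v x)).trans (by
      have := pow_le_pow_left₀ (norm_nonneg _) (nω x) 2
      rw [hW₀]; linarith)
  have cwt : Continuous wt := ((cω.norm.pow 2).add continuous_const).rpow_const fun x => Or.inr (by norm_num)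
  -- `ω, ∂ᵢω ∈ L²`
  have l2ω : ∫⁻ x, ‖curl v x‖ₑ ^ 2 < ⊤ := by
    refine lintegral_enorm_sq_lt_top_of_norm_le_const_mul ‖curlCLM‖ (fun x => ?_) h1
    rw [← norm_iteratedFDeriv_fderiv, norm_iteratedFDeriv_zero]
    exact norm_curl_le v x
  have l2dω : ∀ i, ∫⁻ x, ‖fderiv ℝ (curl v) x (e i)‖ₑ ^ 2 < ⊤ := fun i => by
    refine lintegral_enorm_sq_lt_top_of_norm_le_const_mul ‖curlCLM‖ (fun x => ?_) h2
    calc ‖fderiv ℝ (curl v) x (e i)‖ ≤ ‖fderiv ℝ (curl v) x‖ := by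
          simpa [he1] using (fderiv ℝ (curl v) x).le_opNorm (e i)
      _ ≤ ‖curlCLM‖ * ‖iteratedFDeriv ℝ 2 v x‖ := norm_fderiv_curl_le hv2 x
  -- the two Hölder factors `f = √wt ‖ω‖`, `g = √wt √A`, `A = Σᵢ‖∂ᵢω‖²`
  set A : EuclideanSpace ℝ (Fin 3) → ℝ := fun x => ∑ i, ‖fderiv ℝ (curl v) x (e i)‖ ^ 2 with hA
  have hA0 : ∀ x, 0 ≤ A x := fun x => Finset.sum_nonneg fun i _ => sq_nonneg _
  have cA : Continuous A := continuous_finsetSum _ fun i _ => (cDωe i).norm.pow 2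
  set f : EuclideanSpace ℝ (Fin 3) → ℝ := fun x => Real.sqrt (wt x) * ‖curl v x‖ with hf
  set g : EuclideanSpace ℝ (Fin 3) → ℝ := fun x => Real.sqrt (wt x) * Real.sqrt (A x) with hg
  have hf0 : ∀ x, 0 ≤ f x := fun x => mul_nonneg (Real.sqrt_nonneg _) (norm_nonneg _)
  have hg0 : ∀ x, 0 ≤ g x := fun x => mul_nonneg (Real.sqrt_nonneg _) (Real.sqrt_nonneg _)
  have cf : Continuous f := (cwt.sqrt).mul cω.norm
  have cg : Continuous g := (cwt.sqrt).mul cA.sqrt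
  have hf2 : ∀ x, f x ^ 2 = wt x * ‖curl v x‖ ^ 2 := fun x => by
    rw [hf]; simp only; rw [mul_pow, Real.sq_sqrt (hwt0 x)]
  have hg2 : ∀ x, g x ^ 2 = wt x * A x := fun x => by
    rw [hg]; simp only; rw [mul_pow, Real.sq_sqrt (hwt0 x), Real.sq_sqrt (hA0 x)]
  -- integrability of `f²`, `g²`
  have isqω : Integrable (fun x => ‖curl v x‖ ^ 2) volume := integrable_sq_norm_of_lintegral_lt_top cω l2ω
  have isq : ∀ i, Integrable (fun x => ‖fderiv ℝ (curl v) x (e i)‖ ^ 2) volume := fun i =>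
    integrable_sq_norm_of_lintegral_lt_top (cDωe i) (l2dω i)
  have iA : Integrable A volume := integrable_finsetSum _ fun i _ => isq i
  have if2 : Integrable (fun x => f x ^ 2) volume := by
    refine Integrable.mono' (isqω.const_mul W₀) (cf.pow 2).aestronglyMeasurable
      (Eventually.of_forall fun x => ?_)
    rw [Real.norm_of_nonneg (sq_nonneg _), hf2]
    exact mul_le_mul_of_nonneg_right (hwt x) (sq_nonneg _)
  have ig2 : Integrable (fun x => g x ^ 2) volume := by
    refine Integrable.mono' (iA.const_mul W₀) (cg.pow 2).aestronglyMeasurable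
      (Eventually.of_forall fun x => ?_)
    rw [Real.norm_of_nonneg (sq_nonneg _), hg2]
    exact mul_le_mul_of_nonneg_right (hwt x) (hA0 x)
  have mf : MemLp f 2 volume := (memLp_two_iff_integrable_sq cf.aestronglyMeasurable).2 if2
  have mg : MemLp g 2 volume := (memLp_two_iff_integrable_sq cg.aestronglyMeasurable).2 ig2
  -- pointwise bound `|wt ⟪Dω ω, v⟫| ≤ M f g`
  have hpt : ∀ x, ‖wt x * ⟪fderiv ℝ (curl v) x (curl v x), v x⟫‖ ≤ M * (f x * g x) := by
    intro x
    have hop : ‖fderiv ℝ (curl v) x‖ ≤ Real.sqrt (A x) := by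
      refine Real.le_sqrt_of_sq_le ?_
      exact sq_opNorm_le_sum_sq_norm_apply e (fderiv ℝ (curl v) x)
    have h1' : ‖fderiv ℝ (curl v) x (curl v x)‖ ≤ Real.sqrt (A x) * ‖curl v x‖ :=
      ((fderiv ℝ (curl v) x).le_opNorm _).trans (mul_le_mul_of_nonneg_right hop (norm_nonneg _))
    have h2' : ‖⟪fderiv ℝ (curl v) x (curl v x), v x⟫‖ ≤ Real.sqrt (A x) * ‖curl v x‖ * M :=
      (norm_inner_le_norm _ _).trans (mul_le_mul h1' (hM x) (norm_nonneg _) (by positivity))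
    rw [norm_mul, Real.norm_of_nonneg (hwt0 x)]
    have hfg : f x * g x = wt x * (‖curl v x‖ * Real.sqrt (A x)) := by
      rw [hf, hg]; simp only
      rw [show Real.sqrt (wt x) * ‖curl v x‖ * (Real.sqrt (wt x) * Real.sqrt (A x)) =
        (Real.sqrt (wt x) * Real.sqrt (wt x)) * (‖curl v x‖ * Real.sqrt (A x)) by ring,
        Real.mul_self_sqrt (hwt0 x)]
    rw [hfg]
    nlinarith [mul_le_mul_of_nonneg_left h2' (hwt0 x), hwt0 x]
  -- Hölder
  have hH := integral_mul_le_Lp_mul_Lq_of_nonneg (p := 2) (q := 2) (μ := volume)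
    (Real.HolderConjugate.two_two) (Eventually.of_forall hf0) (Eventually.of_forall hg0)
    (by simpa using mf) (by simpa using mg)
  have hfg_int : Integrable (fun x => f x * g x) volume := MemLp.integrable_mul mf mg
  calc |∫ x, wt x * ⟪fderiv ℝ (curl v) x (curl v x), v x⟫|
      = ‖∫ x, wt x * ⟪fderiv ℝ (curl v) x (curl v x), v x⟫‖ := (Real.norm_eq_abs _).symm
    _ ≤ ∫ x, ‖wt x * ⟪fderiv ℝ (curl v) x (curl v x), v x⟫‖ := norm_integral_le_integral_norm _
    _ ≤ ∫ x, M * (f x * g x) :=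
        integral_mono_of_nonneg (Eventually.of_forall fun x => norm_nonneg _)
          (hfg_int.const_mul M) (Eventually.of_forall hpt)
    _ = M * ∫ x, f x * g x := integral_const_mul _ _
    _ ≤ M * ((∫ x, f x ^ (2:ℝ)) ^ (1 / (2:ℝ)) * (∫ x, g x ^ (2:ℝ)) ^ (1 / (2:ℝ))) :=
        mul_le_mul_of_nonneg_left hH hM0
    _ = 1 * M * Real.sqrt (∫ x, wt x * ‖curl v x‖ ^ 2) * Real.sqrt (∫ x, wt x * A x) := by
        rw [one_mul, Real.sqrt_eq_rpow, Real.sqrt_eq_rpow]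
        have e1 : (∫ x, f x ^ (2:ℝ)) = ∫ x, wt x * ‖curl v x‖ ^ 2 :=
          integral_congr_ae (Eventually.of_forall fun x => by
            simp only; rw [Real.rpow_two, hf2])
        have e2 : (∫ x, g x ^ (2:ℝ)) = ∫ x, wt x * A x :=
          integral_congr_ae (Eventually.of_forall fun x => by
            simp only; rw [Real.rpow_two, hg2])
        rw [e1, e2]; ring

/-- Consistency check (an `example`, since the statement is `rung_of_sq_lt_window` verbatim):
`rung_of_depletion_fiveHalves law_one` re-derives `X_C` for `(1 + 1/2)C² < 8/5`, i.e. `C² < 16/15`. -/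
example {C : ℝ} (hC0 : 0 < C) (hC : C ^ 2 < 16 / 15) :
    ∀ (ν T : ℝ), 0 < ν → 0 < T →
      ∀ (u : ℝ → EuclideanSpace ℝ (Fin 3) → EuclideanSpace ℝ (Fin 3))
        (p : ℝ → EuclideanSpace ℝ (Fin 3) → ℝ),
      IsClassicalNSSolutionOn (Set.Ico 0 T) ν 0 u p → IsLerayHopfOn T ν 0 (u 0) u →
      HasRapidSpatialDecay (u 0) →
      (∀ᶠ t in 𝓝[<] T, ∀ x, Real.sqrt (T - t) * ‖u t x‖ ≤ C * Real.sqrt ν) →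
      HasSmoothExtensionPast ν 0 u T :=
  rung_of_depletion_fiveHalves (κ := 1) law_one hC0 (by nlinarith)

end Summit.NavierStokesRegularity.NavierStokesRegularity.Theorems.FiveHalvesWindow

end
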